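import Summits.QuantumFields.YangMills.Theorems.AllWindowsColdBoxBoxHighWindowsSU22LineDefs
import Literature.MathematicalPhysics.QuantumLattice.LatticeGaugeDLRProofs

/-!
# TASK T-S5/U5 step (1): interior gauge invariance of the cold-wall box state (`BoxStateInteriorGaugeInvariant`, T-S5.0)
# and the smeared Faddeev–Popov identity (`SmearedFPIdentity`, T-S5.1)

Planner ym-idea-2 g17's typed task `Cruxes/BoxWindowHighSU2213/TaskS5FP.lean` (sha12 aa15490368a8) — the SHARED first step of the XL
comparison stubs S5 (LINE-19 ⟨stmt-QuantumFields-24004⟩/⟨24335⟩) and U5 (LINE-20 ⟨24336⟩).  The task's objects and Props are copied here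
VERBATIM (a `Cruxes/` file is not importable from `Theorems/`): `InteriorGauge`, `extendGauge`, `interiorGaugeMeasure`, `orbitAverage`,
`BoxStateInteriorGaugeInvariant` (T-S5.0), `SmearedFPIdentity` (T-S5.1).

Proved here: **T-S5.0 `boxStateInteriorGaugeInvariant : BoxStateInteriorGaugeInvariant`** — the box state
`boxState ρ β H = γ_Λ(· | 1)`, `Λ = boxEdges 4 (2H+1)`, is invariant under gauge transformations supported on the interior sites: the Wilson
specification is gauge covariant (`ymSpecification_map_gaugeTransformZd_holds`), and an interior gauge transformation fixes the flat datum
on every edge outside the box (such an edge has no interior endpoint), so the transformed datum agrees with `1` off `Λ` and the kernel only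
sees the datum off `Λ`.

Appended (seat ym-line-sfw-p2-w5 g21, following w2 g29's handoff plan): **T-S5.1 `smearedFPIdentity : SmearedFPIdentity`** — gauge
averaging: the orbit average `N_h` is invariant under interior gauge transformations (`gaugeTransformZd` is an action, `extendGauge` is
multiplicative, the finite product of Haar probability measures is right invariant), `(U, k) ↦ F U · h (U^{ext k}) / N_h U` is integrable on
`boxState ⊗ interiorGaugeMeasure` (`integrable_prod_iff`: the `k`-integral of its norm is `‖F U‖`), and Fubini together with T-S5.0 and
the invariance of `F` and `N_h` gives `∫ F · h / N_h dμ = ∫ F dμ`.  Measure theory only.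

HONEST LABEL: T-S5.0 and T-S5.1 only (step (1b), the Laplace asymptotics of `N_h`, is not typed here); S5, U5 and the cruxes
⟨24004⟩ ⟨24335⟩ ⟨24336⟩ remain OPEN; no summit is proved; the Yang–Mills mass gap is NOT proved by this file.
-/

set_option autoImplicit false

noncomputable section

open MeasureTheory Matrix
open Literature.MathematicalPhysics.QuantumFieldTheory
open Literature.MathematicalPhysics.QuantumLattice
open Summit.QuantumFields.YangMills.Theorems.WeakCouplingRates

namespace Summit.QuantumFields.YangMills.Theorems.AllWindowsColdBoxBoxHighLine

/-! ## The task's objects (verbatim from `TaskS5FP.lean`) -/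

/-- Interior gauge transformations as functions on the finite set of interior sites. -/
abbrev InteriorGauge (H : ℕ) : Type := ↥(interiorSites H) → SU2

/-- Extension by the identity off the interior sites (so `IsInteriorGauge H (extendGauge H g)` holds by construction). -/
def extendGauge (H : ℕ) (g : InteriorGauge H) : Literature.Probability.LatticeModels.Site 4 → SU2 :=
  fun x => if hx : x ∈ interiorSites H then g ⟨x, hx⟩ else 1

/-- Product Haar probability on the interior gauge transformations. -/
def interiorGaugeMeasure (H : ℕ) : Measure (InteriorGauge H) :=
  Measure.pi fun _ => haarProbability SU2

/-- Orbit average `N_h(U) = ∫ h(U^g) dg` of a weight over interior gauge transformations. -/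
def orbitAverage (H : ℕ) (h : LGConfig 4 SU2 → ℝ) (U : LGConfig 4 SU2) : ℝ :=
  ∫ g, h (gaugeTransformZd (extendGauge H g) U) ∂(interiorGaugeMeasure H)

/-- **T-S5.0 (S).** The cold-wall box state is invariant under interior gauge transformations
(from `ymSpecification_map_gaugeTransformZd_holds` and the fact that an interior `g` fixes the flat datum off the box). -/
def BoxStateInteriorGaugeInvariant : Prop :=
  ∀ (β : ℝ) (H : ℕ) (g : InteriorGauge H),
    (boxState (fundamentalRep (Fin 2)) β H).map (gaugeTransformZd (extendGauge H g)) =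
      boxState (fundamentalRep (Fin 2)) β H

/-- **T-S5.1 (S–M) smeared Faddeev–Popov identity.**  For an interior-gauge-invariant integrable observable `F`, a measurable weight
`0 ≤ h ≤ M` with everywhere-positive orbit average, reweighting by `h / N_h` does not change the box expectation of `F`. -/
def SmearedFPIdentity : Prop :=
  ∀ (β : ℝ) (H : ℕ) (F h : LGConfig 4 SU2 → ℝ),
    (∀ g : InteriorGauge H, ∀ U, F (gaugeTransformZd (extendGauge H g) U) = F U) →
    Integrable F (boxState (fundamentalRep (Fin 2)) β H) →
    Measurable h → (∀ U, 0 ≤ h U) → (∃ M : ℝ, ∀ U, h U ≤ M) →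
    (∀ U, 0 < orbitAverage H h U) →
    ∫ U, F U * (h U / orbitAverage H h U) ∂(boxState (fundamentalRep (Fin 2)) β H) =
      ∫ U, F U ∂(boxState (fundamentalRep (Fin 2)) β H)

/-! ## T-S5.0 -/

/-- The extended gauge transformation is the identity off the interior sites. -/
theorem extendGauge_of_not_mem {H : ℕ} (g : InteriorGauge H) {x : Literature.Probability.LatticeModels.Site 4}
    (hx : x ∉ interiorSites H) : extendGauge H g x = 1 := by
  unfold extendGauge; rw [dif_neg hx]

/-- `IsInteriorGauge H (extendGauge H g)`. -/
theorem isInteriorGauge_extendGauge {H : ℕ} (g : InteriorGauge H) : IsInteriorGauge H (extendGauge H g) :=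
  fun _ hx => extendGauge_of_not_mem g hx

/-- An edge with an interior endpoint is an edge of the box. -/
theorem mem_boxEdges_of_endpoint_mem {H : ℕ} (e : Literature.MathematicalPhysics.QuantumLattice.ZdEdge 4)
    (h : e.1 ∈ interiorSites H ∨ e.1 + Pi.single e.2 1 ∈ interiorSites H) : e ∈ AxialGauge.boxEdges 4 (2 * H + 1) := by
  have hE : e = (e.1, e.2) := rfl
  rw [hE, AxialGauge.mem_boxEdges_iff]
  simp only [interiorSites, Fintype.mem_piFinset, Finset.mem_Icc] at h
  rcases h with h | h
  · refine ⟨fun k => ?_, ?_⟩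
    · have := h k; push_cast; omega
    · have := h e.2; push_cast; omega
  · refine ⟨fun k => ?_, ?_⟩
    · have := h k
      by_cases hk : k = e.2
      · subst hk; simp only [Pi.add_apply, Pi.single_eq_same] at this; push_cast; omega
      · simp only [Pi.add_apply, Pi.single_apply, hk, if_false, add_zero] at this; push_cast; omega
    · have := h e.2; simp only [Pi.add_apply, Pi.single_eq_same] at this; push_cast; omega

/-- An interior gauge transformation fixes the flat datum on every edge outside the box. -/
theorem gaugeTransformZd_extendGauge_one_of_not_mem {H : ℕ} (g : InteriorGauge H) {e : Literature.MathematicalPhysics.QuantumLattice.ZdEdge 4}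
    (he : e ∉ AxialGauge.boxEdges 4 (2 * H + 1)) :
    gaugeTransformZd (extendGauge H g) (fun _ => (1 : SU2)) e = 1 := by
  have h1 : e.1 ∉ interiorSites H := fun hc => he (mem_boxEdges_of_endpoint_mem e (Or.inl hc))
  have h2 : e.1 + Pi.single e.2 1 ∉ interiorSites H := fun hc => he (mem_boxEdges_of_endpoint_mem e (Or.inr hc))
  simp [gaugeTransformZd, extendGauge_of_not_mem g h1, extendGauge_of_not_mem g h2]

/-- **T-S5.0: the cold-wall box state is invariant under interior gauge transformations.** -/
theorem boxStateInteriorGaugeInvariant : BoxStateInteriorGaugeInvariant := by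
  intro β H g
  haveI : SecondCountableTopology SU2 := inferInstance
  unfold boxState
  rw [ymSpecification_map_gaugeTransformZd_holds (fundamentalRep (Fin 2)) (continuous_fundamentalRep (Fin 2)) β
    (AxialGauge.boxEdges 4 (2 * H + 1)) (fun _ => 1) (extendGauge H g)]
  -- the kernel only sees the datum off the box, where the transformed datum is still `1`
  have hg : (fun x : (↥(AxialGauge.boxEdges 4 (2 * H + 1)) → SU2) =>
        Literature.Probability.LatticeModels.glueWith (AxialGauge.boxEdges 4 (2 * H + 1)) x
          (gaugeTransformZd (extendGauge H g) fun _ => (1 : SU2))) =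
      fun x => Literature.Probability.LatticeModels.glueWith (AxialGauge.boxEdges 4 (2 * H + 1)) x fun _ => (1 : SU2) := by
    funext x; funext e
    by_cases he : e ∈ AxialGauge.boxEdges 4 (2 * H + 1)
    · simp [Literature.Probability.LatticeModels.glueWith, he]
    · simp [Literature.Probability.LatticeModels.glueWith, he, gaugeTransformZd_extendGauge_one_of_not_mem g he]
  unfold ymSpecification
  rw [hg]

/-! ## T-S5.1: the smeared Faddeev–Popov identity

Gauge averaging ('t Hooft smearing).  Write `μ = boxState ρ β H`, `π = interiorGaugeMeasure H` (a finite product of Haar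
probability measures, hence a right-invariant probability measure: compact groups are unimodular) and `N = orbitAverage H h`.
* `N` is invariant under interior gauge transformations: `T_{ext k} (T_{ext g} U) = T_{ext (k g)} U` (`gaugeTransformZd` is an
  action and `extendGauge` is multiplicative) and `∫ φ (k g) dπ(k) = ∫ φ k dπ(k)`.
* The function `Φ (U, k) = F U · h (T_{ext k} U) / N U` is integrable on `μ ⊗ π`: for fixed `U` it is bounded by
  `‖F U‖ · M / N U`, and `∫ ‖Φ (U, k)‖ dπ(k) = ‖F U‖ · N U / N U = ‖F U‖` is `μ`-integrable (`integrable_prod_iff`).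
* Fubini: `∫∫ Φ dπ dμ = ∫ F dμ` (inner integral `= F U`), while for every fixed `k` the invariance of `μ` (T-S5.0), of `F`
  and of `N` under `T_{ext k}` gives `∫ Φ (U, k) dμ(U) = ∫ F · h / N dμ`; integrating the constant over the probability
  measure `π` yields the identity.
Measure theory only (Mathlib); no group-specific analysis. -/

/-- Gauge transformations compose: `T_g (T_{g'} U) = T_{g g'} U` (pointwise product of the gauge functions). -/
theorem gaugeTransformZd_gaugeTransformZd_eq (g g' : Literature.Probability.LatticeModels.Site 4 → SU2) (U : LGConfig 4 SU2) :
    gaugeTransformZd g (gaugeTransformZd g' U) = gaugeTransformZd (g * g') U := by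
  funext e
  simp only [gaugeTransformZd, Pi.mul_apply, _root_.mul_inv_rev, mul_assoc]

/-- On the interior sites the extended gauge transformation is the given one. -/
theorem extendGauge_of_mem {H : ℕ} (g : InteriorGauge H) {x : Literature.Probability.LatticeModels.Site 4}
    (hx : x ∈ interiorSites H) : extendGauge H g x = g ⟨x, hx⟩ := by
  unfold extendGauge; rw [dif_pos hx]

/-- `extendGauge H` is multiplicative (both factors are `1` off the interior sites). -/
theorem extendGauge_mul {H : ℕ} (g k : InteriorGauge H) : extendGauge H (g * k) = extendGauge H g * extendGauge H k := by
  funext x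
  by_cases hx : x ∈ interiorSites H
  · simp only [Pi.mul_apply, extendGauge_of_mem _ hx]
  · simp only [Pi.mul_apply, extendGauge_of_not_mem _ hx, mul_one]

/-- Evaluation of `extendGauge H k` at a fixed site is measurable in `k`. -/
theorem measurable_extendGauge_apply (H : ℕ) (x : Literature.Probability.LatticeModels.Site 4) :
    Measurable fun k : InteriorGauge H => extendGauge H k x := by
  by_cases hx : x ∈ interiorSites H
  · simp only [extendGauge_of_mem _ hx]
    exact measurable_pi_apply _
  · simp only [extendGauge_of_not_mem _ hx]
    exact measurable_const

/-- A fixed gauge transformation is a measurable self-map of the configuration space. -/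
theorem measurable_gaugeTransformZd_su2 (g : Literature.Probability.LatticeModels.Site 4 → SU2) :
    Measurable (gaugeTransformZd g : LGConfig 4 SU2 → LGConfig 4 SU2) := by
  refine measurable_pi_lambda _ fun e => ?_
  show Measurable fun U : LGConfig 4 SU2 => g e.1 * U e * (g (e.1 + Pi.single e.2 1))⁻¹
  exact (measurable_const.mul (measurable_pi_apply e)).mul measurable_const

/-- Joint measurability of `(U, k) ↦ gaugeTransformZd (extendGauge H k) U`. -/
theorem measurable_gaugeTransformZd_extendGauge (H : ℕ) :
    Measurable fun p : LGConfig 4 SU2 × InteriorGauge H => gaugeTransformZd (extendGauge H p.2) p.1 := by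
  refine measurable_pi_lambda _ fun e => ?_
  show Measurable fun p : LGConfig 4 SU2 × InteriorGauge H =>
    extendGauge H p.2 e.1 * p.1 e * (extendGauge H p.2 (e.1 + Pi.single e.2 1))⁻¹
  exact (((measurable_extendGauge_apply H e.1).comp measurable_snd).mul
    ((measurable_pi_apply e).comp measurable_fst)).mul
    ((measurable_extendGauge_apply H _).comp measurable_snd).inv

/-- The product Haar measure on the interior gauge transformations is a probability measure. -/
theorem isProbabilityMeasure_interiorGaugeMeasure (H : ℕ) : IsProbabilityMeasure (interiorGaugeMeasure H) := by
  unfold interiorGaugeMeasure; infer_instance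

/-- **The orbit average is invariant under interior gauge transformations**: `N (T_{ext g} U) = N U`
(`T` is an action, `extendGauge` is multiplicative, and the product Haar probability measure is right invariant). -/
theorem orbitAverage_gaugeTransformZd (H : ℕ) (h : LGConfig 4 SU2 → ℝ) (g : InteriorGauge H) (U : LGConfig 4 SU2) :
    orbitAverage H h (gaugeTransformZd (extendGauge H g) U) = orbitAverage H h U := by
  unfold orbitAverage interiorGaugeMeasure
  simp_rw [gaugeTransformZd_gaugeTransformZd_eq, ← extendGauge_mul]
  exact integral_mul_right_eq_self (μ := Measure.pi fun _ : ↥(interiorSites H) => haarProbability SU2)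
    (fun k : InteriorGauge H => h (gaugeTransformZd (extendGauge H k) U)) g

/-- The orbit average of a measurable weight is measurable (Fubini measurability). -/
theorem measurable_orbitAverage (H : ℕ) {h : LGConfig 4 SU2 → ℝ} (hm : Measurable h) :
    Measurable (orbitAverage H h) := by
  haveI := isProbabilityMeasure_interiorGaugeMeasure H
  have hF : StronglyMeasurable (Function.uncurry fun (U : LGConfig 4 SU2) (k : InteriorGauge H) =>
      h (gaugeTransformZd (extendGauge H k) U)) :=
    (hm.comp (measurable_gaugeTransformZd_extendGauge H)).stronglyMeasurable
  exact (hF.integral_prod_right (ν := interiorGaugeMeasure H)).measurable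

/-- **T-S5.1: the smeared Faddeev–Popov identity** `∫ F · h / N_h dμ = ∫ F dμ` for the cold-wall box state `μ`, an
interior-gauge-invariant integrable `F` and a bounded measurable weight `h ≥ 0` with positive orbit average `N_h`. -/
theorem smearedFPIdentity : SmearedFPIdentity := by
  intro β H F h hF hFi hm h0 hM hN
  obtain ⟨M, hM⟩ := hM
  haveI := isProbabilityMeasure_interiorGaugeMeasure H
  set μ := boxState (fundamentalRep (Fin 2)) β H with hμ
  set π := interiorGaugeMeasure H with hπ
  have hNm : Measurable (orbitAverage H h) := measurable_orbitAverage H hm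
  -- the integrand on the product space
  set Φ : LGConfig 4 SU2 × InteriorGauge H → ℝ :=
    fun p => F p.1 * (h (gaugeTransformZd (extendGauge H p.2) p.1) / orbitAverage H h p.1) with hΦ
  have hΦm : AEStronglyMeasurable Φ (μ.prod π) := by
    have h1 : AEStronglyMeasurable (fun p : LGConfig 4 SU2 × InteriorGauge H => F p.1) (μ.prod π) :=
      hFi.aestronglyMeasurable.comp_fst
    have h2 : Measurable fun p : LGConfig 4 SU2 × InteriorGauge H =>
        h (gaugeTransformZd (extendGauge H p.2) p.1) / orbitAverage H h p.1 :=
      (hm.comp (measurable_gaugeTransformZd_extendGauge H)).div (hNm.comp measurable_fst)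
    exact h1.mul h2.aestronglyMeasurable
  -- inner integrals over the gauge group
  have hinner : ∀ U, ∫ k, Φ (U, k) ∂π = F U := by
    intro U
    simp only [hΦ]
    rw [integral_const_mul, integral_div]
    have : (∫ k, h (gaugeTransformZd (extendGauge H k) U) ∂π) = orbitAverage H h U := rfl
    rw [this, div_self (hN U).ne', mul_one]
  have hnorm : ∀ U, ∫ k, ‖Φ (U, k)‖ ∂π = ‖F U‖ := by
    intro U
    have hk : ∀ k, ‖Φ (U, k)‖ = ‖F U‖ * (h (gaugeTransformZd (extendGauge H k) U) / orbitAverage H h U) := by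
      intro k
      simp only [hΦ, norm_mul, Real.norm_eq_abs]
      rw [abs_of_nonneg (div_nonneg (h0 _) (hN U).le)]
    simp_rw [hk]
    rw [integral_const_mul, integral_div]
    have : (∫ k, h (gaugeTransformZd (extendGauge H k) U) ∂π) = orbitAverage H h U := rfl
    rw [this, div_self (hN U).ne', mul_one]
  -- integrability on the product
  have hint : Integrable Φ (μ.prod π) := by
    rw [integrable_prod_iff hΦm]
    refine ⟨ae_of_all _ fun U => ?_, ?_⟩
    · have hι : Measurable (Prod.mk U : InteriorGauge H → LGConfig 4 SU2 × InteriorGauge H) := measurable_prodMk_left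
      have hT := (measurable_gaugeTransformZd_extendGauge H).comp hι
      have hmk : Measurable fun k : InteriorGauge H =>
          F U * (h (gaugeTransformZd (extendGauge H k) U) / orbitAverage H h U) :=
        measurable_const.mul ((hm.comp hT).div measurable_const)
      simp only [hΦ]
      refine Integrable.of_bound hmk.aestronglyMeasurable (‖F U‖ * (M / orbitAverage H h U))
        (ae_of_all _ fun k => ?_)
      rw [norm_mul, Real.norm_eq_abs, Real.norm_eq_abs, abs_of_nonneg (div_nonneg (h0 _) (hN U).le)]
      exact mul_le_mul_of_nonneg_left (div_le_div_of_nonneg_right (hM _) (hN U).le) (abs_nonneg _)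
    · simp_rw [hnorm]
      exact hFi.norm
  -- for every fixed interior gauge transformation the `U`-integral is the left-hand side
  have hk : ∀ k : InteriorGauge H, ∫ U, Φ (U, k) ∂μ = ∫ U, F U * (h U / orbitAverage H h U) ∂μ := by
    intro k
    have hmap : μ.map (gaugeTransformZd (extendGauge H k)) = μ := boxStateInteriorGaugeInvariant β H k
    have hφm : AEStronglyMeasurable (fun U => F U * (h U / orbitAverage H h U))
        (μ.map (gaugeTransformZd (extendGauge H k))) := by
      rw [hmap]; exact hFi.aestronglyMeasurable.mul (hm.div hNm).aestronglyMeasurable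
    have himap := integral_map (measurable_gaugeTransformZd_su2 (extendGauge H k)).aemeasurable hφm
    rw [hmap] at himap
    rw [himap]
    refine integral_congr_ae (ae_of_all _ fun U => ?_)
    simp only [hΦ, hF k U, orbitAverage_gaugeTransformZd]
  calc ∫ U, F U * (h U / orbitAverage H h U) ∂μ
      = ∫ k, ∫ U, Φ (U, k) ∂μ ∂π := by simp_rw [hk]; simp
    _ = ∫ U, ∫ k, Φ (U, k) ∂π ∂μ := (integral_integral_swap hint).symm
    _ = ∫ U, F U ∂μ := by simp_rw [hinner]

end Summit.QuantumFields.YangMills.Theorems.AllWindowsColdBoxBoxHighLine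

end
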